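import Summits.ResolutionOfSingularities.ResolutionOfSingularities.Theorems.HomologicalConductorPersistenceMonomialValuationKC3
import HarnessLib

/-!
# Crux `Persistence` (stmt-ResolutionOfSingularities-16484), chain W4.4b K-C3 — K3a follow-up «CENTRE LEMMA»:
# the centre of `O_w` on `A = k[x, z, t, (z³+t⁴)x⁻¹]` is the origin — `loc O_w A` inverts EXACTLY the elements of `A` off `P = (x, y, z, t)`

Route `ResolutionOfSingularities/HomologicalConductor`. OURS (cell res-hironaka, chain W4.4b K-C3, REFEREE-KC3 934cc3b7642bc99f L0 «centre of v
on A is 𝔪 = (x,y,z,t); s ∈ A ∖ 𝔪 has v(s) = 0 ⇒ T₀ = loc O A = A_𝔪»; seat res-type-084 g11, OWN-OBJECT 2026-08-27T12:11:45Z). The VALUATION-SIDE half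
of «T₀ = A_P» only: the ring isomorphisms `A ≃ k[X₀..X₃]/(X₀X₁ − X₂³ − X₃⁴)` / `↥(loc O A) ≃ Localization.AtPrime P _` are NOT here (res-type-010 /
res-type-011 / res-D-pv-058, K2c (c1)). Nothing here is a statement of the manuscript under review (Hironaka 2017); nothing concludes the crux;
AI-written, weaker than expert review.

* §1 GENERIC (any valuation `v` on a field `K ⊇ k` with `∀ c, v (algebraMap k K c) ≤ 1`, any family `g : σ → K` with `∀ i, v (g i) < 1`,
  any `G : MvPolynomial σ k`): `valuation_algebraMap_eq_one` (`c ≠ 0 ⇒ v c = 1`), `valuation_prod_pow_lt_one` (a non-constant monomial in the `g i`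
  has `v < 1`), **`valuation_aeval_sub_lt_one`** (`v (G(g) − G(0)) < 1`), `valuation_aeval_le_one`, **`valuation_aeval_eq_one_iff`**
  (`v (G(g)) = 1 ↔ G(0) ≠ 0`), `valuation_aeval_lt_one_iff` (`v (G(g)) < 1 ↔ G(0) = 0`), `aeval_mem_valuationSubring`,
  **`inv_aeval_mem_valuationSubring_iff`** (`G(g) ≠ 0`: `G(g)⁻¹ ∈ O_v ↔ G(0) ≠ 0`).
* §2 K-C3 (KC3 SPELLING v1; `O_w = monomialValuationRing k (kc3Weight N) K`, `kc3Weight N = ![6, 4+N, 3+N]`, v1: `N = 1`; the generator family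
  `![x, y, z, t] : Fin 4 → K` in res-type-010's `f₀ = X 0 * X 1 − X 2 ^ 3 − X 3 ^ 4` variable order, `x z t = algebraMap _ K (X 0 / X 1 / X 2)`,
  `y = (z³ + t⁴)·x⁻¹`): `kc3_gen_valuation_lt_one` (all four generators lie in the maximal ideal of `O_w`, every `N`),
  **`kc3_valuation_aeval_eq_one_iff`** / `kc3_valuation_aeval_lt_one_iff` / `kc3_aeval_mem` / **`kc3_inv_aeval_mem_iff`** (for every
  `G : MvPolynomial (Fin 4) k`: `G(x,y,z,t)⁻¹ ∈ O_w ↔ G(0) ≠ 0` when `G(x,y,z,t) ≠ 0`), `kc3_adjoin_eq_range_aeval`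
  (`A = Algebra.adjoin k {x, z, t, y} = (aeval ![x, y, z, t]).range`, SPELLING's set literal), and **`kc3_inv_mem_iff_of_mem_adjoin`**
  (`s ∈ A`, `s ≠ 0`: `s⁻¹ ∈ O_w ↔ ∃ G, aeval ![x,y,z,t] G = s ∧ G(0) ≠ 0`) — so `loc O_w A` (route vocabulary `NoZeno.Birth.loc`) adjoins exactly the
  inverses of the elements of `A` with a representative off the origin.
[folklore] throughout (ultrametric inequality); OURS data; def-free.
-/

noncomputable section

-- single-problem summit: the doubled namespace component `ResolutionOfSingularities` is forced
set_option linter.dupNamespace false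

open MvPolynomial WithZero
open Literature.AlgebraicGeometry.Resolution.WeightedBlowup

namespace Summit.ResolutionOfSingularities.ResolutionOfSingularities.Theorems.HomologicalConductor.PersistenceMonomialValuation

universe u

/-! ## §1 Generic: polynomial expressions in elements of the maximal ideal of a valuation ring containing `k` -/

section Generic

variable {k K : Type} [Field k] [Field K] [Algebra k K] {Γ₀ : Type} [LinearOrderedCommGroupWithZero Γ₀] (v : Valuation K Γ₀)
  (hk : ∀ c : k, v (algebraMap k K c) ≤ 1)

include hk in
/-- If `k ⊆ O_v` then every non-zero constant is a unit of `O_v`: `v c = 1`. [folklore] -/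
theorem valuation_algebraMap_eq_one {c : k} (hc : c ≠ 0) : v (algebraMap k K c) = 1 := by
  refine le_antisymm (hk c) ?_
  have h := hk c⁻¹
  have hpos : 0 < v (algebraMap k K c) := zero_lt_iff.mpr ((Valuation.ne_zero_iff v).mpr ((map_ne_zero _).mpr hc))
  rwa [map_inv₀, map_inv₀, inv_le_one₀ hpos] at h

variable {σ : Type u} {g : σ → K}

omit [Algebra k K] in
/-- A non-constant monomial in elements of value `< 1` has value `< 1`. [folklore] -/
theorem valuation_prod_pow_lt_one (hg : ∀ i, v (g i) < 1) {d : σ →₀ ℕ} (hd : d ≠ 0) :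
    v (∏ i ∈ d.support, g i ^ d i) < 1 := by
  classical
  obtain ⟨i, hi⟩ := DFunLike.ne_iff.mp hd
  have hi' : i ∈ d.support := Finsupp.mem_support_iff.mpr hi
  rw [map_prod, ← Finset.mul_prod_erase _ _ hi']
  refine mul_lt_one_of_lt_of_le ?_ (Finset.prod_le_one' fun j _ => ?_)
  · obtain ⟨m, hm⟩ := Nat.exists_eq_succ_of_ne_zero hi
    rw [Valuation.map_pow, hm, pow_succ']
    exact mul_lt_one_of_lt_of_le (hg i) (pow_le_one' (hg i).le _)
  · rw [Valuation.map_pow]; exact pow_le_one' (hg j).le _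

include hk in
/-- **Ultrametric centre lemma**: for `g i` of value `< 1`, `v (G(g) − G(0)) < 1` for every polynomial `G` over `k`. [folklore] -/
theorem valuation_aeval_sub_lt_one (hg : ∀ i, v (g i) < 1) (G : MvPolynomial σ k) :
    v (MvPolynomial.aeval g G - algebraMap k K (constantCoeff G)) < 1 := by
  classical
  have key : MvPolynomial.aeval g G - algebraMap k K (constantCoeff G) =
      ∑ d ∈ G.support.erase 0, algebraMap k K (coeff d G) * ∏ i ∈ d.support, g i ^ d i := by
    rw [MvPolynomial.aeval_def, MvPolynomial.eval₂_eq]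
    by_cases h0 : (0 : σ →₀ ℕ) ∈ G.support
    · rw [← Finset.add_sum_erase _ _ h0]
      simp only [Finsupp.support_zero, Finset.prod_empty, mul_one, MvPolynomial.constantCoeff_eq, add_sub_cancel_left]
    · have hc : constantCoeff G = 0 := by
        rw [MvPolynomial.mem_support_iff, not_not] at h0
        simpa only [MvPolynomial.constantCoeff_eq] using h0
      rw [hc, map_zero, sub_zero, Finset.erase_eq_of_notMem h0]
  rw [key]
  refine Valuation.map_sum_lt v one_ne_zero fun d hd => ?_
  rw [Valuation.map_mul, mul_comm]
  exact mul_lt_one_of_lt_of_le (valuation_prod_pow_lt_one v hg (Finset.ne_of_mem_erase hd)) (hk _)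

include hk in
/-- `v (G(g)) ≤ 1` when all `v (g i) ≤ 1` (coefficients from `k ⊆ O_v`). [folklore] -/
theorem valuation_aeval_le_one (hg : ∀ i, v (g i) ≤ 1) (G : MvPolynomial σ k) : v (MvPolynomial.aeval g G) ≤ 1 := by
  classical
  rw [MvPolynomial.aeval_def, MvPolynomial.eval₂_eq]
  refine Valuation.map_sum_le v fun d _ => ?_
  rw [Valuation.map_mul, map_prod]
  refine mul_le_one' (hk _) (Finset.prod_le_one' fun i _ => ?_)
  rw [Valuation.map_pow]; exact pow_le_one' (hg i) _

include hk in
/-- **`v (G(g)) = 1 ↔ G(0) ≠ 0`** (all `v (g i) < 1`): a polynomial expression in elements of the maximal ideal is a unit of `O_v` iff its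
constant term is non-zero. [folklore] -/
theorem valuation_aeval_eq_one_iff (hg : ∀ i, v (g i) < 1) (G : MvPolynomial σ k) :
    v (MvPolynomial.aeval g G) = 1 ↔ constantCoeff G ≠ 0 := by
  have hlt := valuation_aeval_sub_lt_one v hk hg G
  refine ⟨fun h1 h0 => ?_, fun h0 => ?_⟩
  · rw [h0, map_zero, sub_zero, h1] at hlt
    exact lt_irrefl _ hlt
  · have hc : v (algebraMap k K (constantCoeff G)) = 1 := valuation_algebraMap_eq_one v hk h0
    have e : MvPolynomial.aeval g G = (MvPolynomial.aeval g G - algebraMap k K (constantCoeff G)) + algebraMap k K (constantCoeff G) := by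
      ring
    rw [e, Valuation.map_add_eq_of_lt_right _ (by rwa [hc]), hc]

include hk in
/-- **`v (G(g)) < 1 ↔ G(0) = 0`** (all `v (g i) < 1`). [folklore] -/
theorem valuation_aeval_lt_one_iff (hg : ∀ i, v (g i) < 1) (G : MvPolynomial σ k) :
    v (MvPolynomial.aeval g G) < 1 ↔ constantCoeff G = 0 := by
  rw [(valuation_aeval_le_one v hk (fun i => (hg i).le) G).lt_iff_ne, ne_eq, valuation_aeval_eq_one_iff v hk hg G, not_not]

include hk in
/-- `G(g) ∈ O_v` (all `v (g i) ≤ 1`). [folklore] -/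
theorem aeval_mem_valuationSubring (hg : ∀ i, v (g i) ≤ 1) (G : MvPolynomial σ k) : MvPolynomial.aeval g G ∈ v.valuationSubring :=
  (Valuation.mem_valuationSubring_iff v _).mpr (valuation_aeval_le_one v hk hg G)

include hk in
/-- **`G(g)⁻¹ ∈ O_v ↔ G(0) ≠ 0`** for `G(g) ≠ 0` (all `v (g i) < 1`): the localisation of `k[g]` at the centre of `O_v` inverts exactly the
polynomial expressions with non-zero constant term. [folklore] -/
theorem inv_aeval_mem_valuationSubring_iff (hg : ∀ i, v (g i) < 1) {G : MvPolynomial σ k} (hs : MvPolynomial.aeval g G ≠ 0) :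
    (MvPolynomial.aeval g G)⁻¹ ∈ v.valuationSubring ↔ constantCoeff G ≠ 0 := by
  have hpos : 0 < v (MvPolynomial.aeval g G) := zero_lt_iff.mpr ((Valuation.ne_zero_iff v).mpr hs)
  rw [Valuation.mem_valuationSubring_iff, map_inv₀, inv_le_one₀ hpos, ← valuation_aeval_eq_one_iff v hk hg G]
  exact ⟨fun h => le_antisymm (valuation_aeval_le_one v hk (fun i => (hg i).le) G) h, fun h => h.ge⟩

end Generic

/-! ## §2 K-C3: the four generators of `A` lie in the maximal ideal of `O_w`; `loc O_w A` inverts exactly `A ∖ P` -/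

section KC3

variable (k : Type) [Field k] (K : Type) [Field K] [Algebra (MvPolynomial (Fin 3) k) K] [IsFractionRing (MvPolynomial (Fin 3) k) K]
  [Algebra k K] [IsScalarTower k (MvPolynomial (Fin 3) k) K] (N : ℕ)

/-- `k ⊆ O_w` in the `≤ 1` form. [folklore] -/
theorem kc3_valuation_algebraMap_base_le_one (c : k) : monomialValuationFrac k (kc3Weight N) K (algebraMap k K c) ≤ 1 :=
  kc3_algebraMap_base_mem k K N c

omit [Algebra k K] [IsScalarTower k (MvPolynomial (Fin 3) k) K] in
/-- **All four generators `x, y = (z³+t⁴)x⁻¹, z, t` of `A` have value `< 1`** (they lie in the maximal ideal of `O_w`; every `N`).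
[folklore] -/
theorem kc3_gen_valuation_lt_one (i : Fin 4) :
    monomialValuationFrac k (kc3Weight N) K
        ((![algebraMap (MvPolynomial (Fin 3) k) K (X 0),
            (algebraMap (MvPolynomial (Fin 3) k) K (X 1) ^ 3 + algebraMap (MvPolynomial (Fin 3) k) K (X 2) ^ 4) *
              (algebraMap (MvPolynomial (Fin 3) k) K (X 0))⁻¹,
            algebraMap (MvPolynomial (Fin 3) k) K (X 1), algebraMap (MvPolynomial (Fin 3) k) K (X 2)] : Fin 4 → K) i) < 1 := by
  fin_cases i
  · simp only [Fin.zero_eta, Matrix.cons_val_zero]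
    rw [monomialValuationFrac_X, ← exp_zero, exp_lt_exp, kc3Weight_zero]; norm_num
  · simp only [Fin.mk_one, Matrix.cons_val_one, Matrix.cons_val_zero]
    rw [monomialValuationFrac_kc3_y, ← exp_zero, exp_lt_exp]; omega
  · simp only [Fin.reduceFinMk, Matrix.cons_val]
    rw [monomialValuationFrac_X, ← exp_zero, exp_lt_exp, kc3Weight_one]; omega
  · simp only [Fin.reduceFinMk, Matrix.cons_val]
    rw [monomialValuationFrac_X, ← exp_zero, exp_lt_exp, kc3Weight_two]; omega

/-- **`v (G(x,y,z,t)) = 1 ↔ G(0) ≠ 0`** for every `G : MvPolynomial (Fin 4) k`. [folklore] -/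
theorem kc3_valuation_aeval_eq_one_iff (G : MvPolynomial (Fin 4) k) :
    monomialValuationFrac k (kc3Weight N) K (MvPolynomial.aeval
        (![algebraMap (MvPolynomial (Fin 3) k) K (X 0),
            (algebraMap (MvPolynomial (Fin 3) k) K (X 1) ^ 3 + algebraMap (MvPolynomial (Fin 3) k) K (X 2) ^ 4) *
              (algebraMap (MvPolynomial (Fin 3) k) K (X 0))⁻¹,
            algebraMap (MvPolynomial (Fin 3) k) K (X 1), algebraMap (MvPolynomial (Fin 3) k) K (X 2)] : Fin 4 → K) G) = 1 ↔
      constantCoeff G ≠ 0 :=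
  valuation_aeval_eq_one_iff _ (kc3_valuation_algebraMap_base_le_one k K N) (kc3_gen_valuation_lt_one k K N) G

/-- `v (G(x,y,z,t)) < 1 ↔ G(0) = 0`. [folklore] -/
theorem kc3_valuation_aeval_lt_one_iff (G : MvPolynomial (Fin 4) k) :
    monomialValuationFrac k (kc3Weight N) K (MvPolynomial.aeval
        (![algebraMap (MvPolynomial (Fin 3) k) K (X 0),
            (algebraMap (MvPolynomial (Fin 3) k) K (X 1) ^ 3 + algebraMap (MvPolynomial (Fin 3) k) K (X 2) ^ 4) *
              (algebraMap (MvPolynomial (Fin 3) k) K (X 0))⁻¹,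
            algebraMap (MvPolynomial (Fin 3) k) K (X 1), algebraMap (MvPolynomial (Fin 3) k) K (X 2)] : Fin 4 → K) G) < 1 ↔
      constantCoeff G = 0 :=
  valuation_aeval_lt_one_iff _ (kc3_valuation_algebraMap_base_le_one k K N) (kc3_gen_valuation_lt_one k K N) G

/-- `G(x,y,z,t) ∈ O_w`. [folklore] -/
theorem kc3_aeval_mem (G : MvPolynomial (Fin 4) k) :
    MvPolynomial.aeval
        (![algebraMap (MvPolynomial (Fin 3) k) K (X 0),
            (algebraMap (MvPolynomial (Fin 3) k) K (X 1) ^ 3 + algebraMap (MvPolynomial (Fin 3) k) K (X 2) ^ 4) *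
              (algebraMap (MvPolynomial (Fin 3) k) K (X 0))⁻¹,
            algebraMap (MvPolynomial (Fin 3) k) K (X 1), algebraMap (MvPolynomial (Fin 3) k) K (X 2)] : Fin 4 → K) G ∈
      monomialValuationRing k (kc3Weight N) K :=
  aeval_mem_valuationSubring _ (kc3_valuation_algebraMap_base_le_one k K N) (fun i => (kc3_gen_valuation_lt_one k K N i).le) G

/-- **`G(x,y,z,t)⁻¹ ∈ O_w ↔ G(0) ≠ 0`** (`G(x,y,z,t) ≠ 0`): `loc O_w A` inverts exactly the elements of `A` off the origin `P = (x,y,z,t)`.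
[folklore] -/
theorem kc3_inv_aeval_mem_iff {G : MvPolynomial (Fin 4) k}
    (hs : MvPolynomial.aeval
        (![algebraMap (MvPolynomial (Fin 3) k) K (X 0),
            (algebraMap (MvPolynomial (Fin 3) k) K (X 1) ^ 3 + algebraMap (MvPolynomial (Fin 3) k) K (X 2) ^ 4) *
              (algebraMap (MvPolynomial (Fin 3) k) K (X 0))⁻¹,
            algebraMap (MvPolynomial (Fin 3) k) K (X 1), algebraMap (MvPolynomial (Fin 3) k) K (X 2)] : Fin 4 → K) G ≠ 0) :
    (MvPolynomial.aeval
        (![algebraMap (MvPolynomial (Fin 3) k) K (X 0),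
            (algebraMap (MvPolynomial (Fin 3) k) K (X 1) ^ 3 + algebraMap (MvPolynomial (Fin 3) k) K (X 2) ^ 4) *
              (algebraMap (MvPolynomial (Fin 3) k) K (X 0))⁻¹,
            algebraMap (MvPolynomial (Fin 3) k) K (X 1), algebraMap (MvPolynomial (Fin 3) k) K (X 2)] : Fin 4 → K) G)⁻¹ ∈
      monomialValuationRing k (kc3Weight N) K ↔ constantCoeff G ≠ 0 :=
  inv_aeval_mem_valuationSubring_iff _ (kc3_valuation_algebraMap_base_le_one k K N) (kc3_gen_valuation_lt_one k K N) hs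

omit [IsFractionRing (MvPolynomial (Fin 3) k) K] [IsScalarTower k (MvPolynomial (Fin 3) k) K] in
/-- **`A = Algebra.adjoin k {x, z, t, y} = (aeval ![x, y, z, t]).range`** (SPELLING v1 set literal; every element of `A` is a polynomial expression
in the four generators). [folklore] -/
theorem kc3_adjoin_eq_range_aeval :
    Algebra.adjoin k ({algebraMap (MvPolynomial (Fin 3) k) K (X 0), algebraMap (MvPolynomial (Fin 3) k) K (X 1),
        algebraMap (MvPolynomial (Fin 3) k) K (X 2),
        (algebraMap (MvPolynomial (Fin 3) k) K (X 1) ^ 3 + algebraMap (MvPolynomial (Fin 3) k) K (X 2) ^ 4) *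
          (algebraMap (MvPolynomial (Fin 3) k) K (X 0))⁻¹} : Set K) =
      (MvPolynomial.aeval
        (![algebraMap (MvPolynomial (Fin 3) k) K (X 0),
            (algebraMap (MvPolynomial (Fin 3) k) K (X 1) ^ 3 + algebraMap (MvPolynomial (Fin 3) k) K (X 2) ^ 4) *
              (algebraMap (MvPolynomial (Fin 3) k) K (X 0))⁻¹,
            algebraMap (MvPolynomial (Fin 3) k) K (X 1), algebraMap (MvPolynomial (Fin 3) k) K (X 2)] : Fin 4 → K)).range := by
  rw [← Algebra.adjoin_range_eq_range_aeval]
  congr 1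
  ext u
  simp only [Matrix.range_cons, Matrix.range_empty, Set.union_empty, Set.singleton_union, Set.mem_insert_iff, Set.mem_singleton_iff]
  tauto

/-- **Centre of `O_w` on `A`**: for `s ∈ A = k[x, z, t, y]`, `s ≠ 0`: `s⁻¹ ∈ O_w` iff `s` has a polynomial representative with non-zero constant term
(equivalently, by `kc3_inv_aeval_mem_iff`, every representative has one) — `loc O_w A` adjoins exactly `(A ∖ P)⁻¹`, `P` = the origin. [folklore] -/
theorem kc3_inv_mem_iff_of_mem_adjoin {s : K}
    (hs : s ∈ Algebra.adjoin k ({algebraMap (MvPolynomial (Fin 3) k) K (X 0), algebraMap (MvPolynomial (Fin 3) k) K (X 1),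
        algebraMap (MvPolynomial (Fin 3) k) K (X 2),
        (algebraMap (MvPolynomial (Fin 3) k) K (X 1) ^ 3 + algebraMap (MvPolynomial (Fin 3) k) K (X 2) ^ 4) *
          (algebraMap (MvPolynomial (Fin 3) k) K (X 0))⁻¹} : Set K)) (hs0 : s ≠ 0) :
    s⁻¹ ∈ monomialValuationRing k (kc3Weight N) K ↔ ∃ G : MvPolynomial (Fin 4) k,
      MvPolynomial.aeval
        (![algebraMap (MvPolynomial (Fin 3) k) K (X 0),
            (algebraMap (MvPolynomial (Fin 3) k) K (X 1) ^ 3 + algebraMap (MvPolynomial (Fin 3) k) K (X 2) ^ 4) *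
              (algebraMap (MvPolynomial (Fin 3) k) K (X 0))⁻¹,
            algebraMap (MvPolynomial (Fin 3) k) K (X 1), algebraMap (MvPolynomial (Fin 3) k) K (X 2)] : Fin 4 → K) G = s ∧
        constantCoeff G ≠ 0 := by
  rw [kc3_adjoin_eq_range_aeval k K] at hs
  obtain ⟨G, rfl⟩ := hs
  refine ⟨fun h => ⟨G, rfl, (kc3_inv_aeval_mem_iff k K N hs0).mp h⟩, ?_⟩
  rintro ⟨G', hG', h0⟩
  have hs0' := hs0
  rw [← hG'] at hs0' ⊢
  exact (kc3_inv_aeval_mem_iff k K N hs0').mpr h0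

end KC3

end Summit.ResolutionOfSingularities.ResolutionOfSingularities.Theorems.HomologicalConductor.PersistenceMonomialValuation

end
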